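import Summits.AtomisticToContinuum.FouriersLaw.Theorems.LatticeLandauDampingAbelThermodynamicLimitUniformAnchoredCorrelationTailsSingleFlip
import Summits.AtomisticToContinuum.FouriersLaw.Theorems.LatticeLandauDampingAbelThermodynamicLimitUniformAnchoredCorrelationTailsBoxSet
import Summits.AtomisticToContinuum.FouriersLaw.Theorems.JunctionLocalityNonBallisticContactCurrentFourthMoment
import Summits.AtomisticToContinuum.FouriersLaw.Theorems.LatticeLandauDampingAbelThermodynamicLimitUniformAnchoredCorrelationTailsAssembly

/-!
# Stub (C′) `stub_uniformAnchoredCorrelationTails` of line `series-law-at-every-laplace-frequency` (crux `LatticeLandauDamping.AbelThermodynamicLimit`) and its engine, the `N`-uniform single-flip light cone of the open pinned chain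

Registered stub (C′) of the lead's skeleton of crux stmt-AtomisticToContinuum-14013
(`Summit.AtomisticToContinuum.FouriersLaw.Theses.LatticeLandauDamping.AbelThermodynamicLimit`), proved at the end of this
file with exactly the registered signature: the LIGHT CONE of the OPEN pinned anharmonic chain (Langevin baths at sites `0`
and `N − 1`, both at temperature `T`, dynamics `transitionKernel N T T t`, stationary measure `gibbsMeasure N T`) at FIXED
time, uniformly over `R`-deep anchors `i`, over `t ∈ [0, τ]` and over the length `N`: the equilibrium space-time
correlations `⟨j_i(0) j_k(t)⟩_{N,T}` summed over `|k − i| > R` are `≤ ε`. **Proof (synchronous coupling).** The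
two-momenta flip `Θ_iΘ_{i+1}` preserves `μ_{N,T}` and negates `j_i`, so by the pairing bound, Jensen in the noise and the
triangle inequality `⟨j_i(0)j_k(t)⟩² ≤ ¼⟨j_i²⟩(2B_{i+1,k} + 2B_{i,k})` with `B_{i₀,k}` the mean square, under Gibbs ⊗ Wiener,
of the difference of `j_k` along two strong solutions driven by the SAME Brownian pair from `x` and from `x` with `p_{i₀}`
flipped (`…PairReduction`); the `N`-UNIFORM single-flip light cone `B_{i₀,k} ≤ (a r^D + b/D²)²` (this file, registered
sub-goal `pinnedChain_singleFlipLocality`: weighted common-noise Dobrushin–Fritz propagation bound `…Propagation`,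
`N`-uniform weighted position box `…SiteTails`/`…BoxSet`, fixed-`N` estimate `…SingleFlip`, `N`-uniform Gibbs fourth
moments of the currents) and the summation over the far bonds (`…Assembly`) conclude.

## The engine (SF)

Helper (`--supports stmt-AtomisticToContinuum-14013`) for the line `series-law-at-every-laplace-frequency`
(SketchIdeator2) of the crux `LatticeLandauDamping.AbelThermodynamicLimit`, stub (C′)
`stub_uniformAnchoredCorrelationTails`. Registered sub-goal `pinnedChain_singleFlipLocality` — VERBATIM the hypothesis
(SF) of the landed reduction `uniformAnchoredCorrelationTails_of_singleFlipLocality`.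

**(SF).** For `P = pinnedChain ω₂ lam β γ` (all `> 0`), `T > 0` and a horizon `τ > 0` there are `a, b ≥ 0`, `r = 15/16`
and `D₀` (depending on `τ` but NOT on `N`) such that for every length `N`, every flipped site `i₀`, every genuine bond
`(k, k+1)` at distance `≥ D ≥ D₀` from `i₀` and every `s ≤ τ`, the two strong solutions of the Langevin chain driven
by the SAME Brownian pair from `x ∼ μ_T` and from `Θ_{i₀}x` satisfy
`E_{μ_T ⊗ W}[(j_k(Φ_s(Θ_{i₀}x)) − j_k(Φ_s x))²] ≤ (a r^D + b/D²)²`.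

Proof: the weighted single-flip estimate `SingleFlip.single_flip_weighted` with the scale `ρ² = √D/(12eAτ')`
(`τ' = τ ⊔ 1`, `A = 3 + ω₂ + 3 lam + 24β + 2γ`; then `ρ ≥ 1` for `D ≥ (12eAτ')²` and the light-cone regime
`6eAρ²√(1+2n)τ ≤ √(D(1+2n))/2 ≤ n` holds for all `n ≥ D`), the `N`-uniform exceptional set of the weighted box
(`pinnedChain_weightedBox_exceptionalSet`, measure `≤ K/ρ^{32} = K(12eAτ')^{16}/D⁸`) and the `N`-uniform fourth moments of
the bond currents (`pinnedChain_contactCurrentFourthMoment`): the cone term is `≤ 28224(1+β)²(195T²+32) ρ⁶(9/16)^D ≤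
(672(1+β)√(195T²+32) (15/16)^D)²` (`ρ⁶ ≤ D²`, `D(3/4)^D ≤ 4(15/16)^D` by Bernoulli) and the bad term is
`4√(2C₄K)(12eAτ')⁸/D⁴`. Folklore; no definitions.
-/

noncomputable section

open MeasureTheory ProbabilityTheory Set Filter Topology
open scoped NNReal ENNReal

namespace Summit.AtomisticToContinuum.FouriersLaw.Theorems.AbelThermodynamicLimit.SeriesLawAtEveryLaplaceFrequency

open Literature.MathematicalPhysics.KineticTheory Literature.MathematicalPhysics.KineticTheory.HeatConduction
open Literature.Probability.Process OscillatorChain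
open Summit.AtomisticToContinuum.FouriersLaw.Theorems.NonBallistic

namespace SingleFlip

/-- Bernoulli: `D (3/4)^D ≤ 4 (15/16)^D` (`(5/4)^D ≥ 1 + D/4 ≥ D/4`). [folklore] -/
theorem mul_threeQuarter_pow_le (D : ℕ) : (D : ℝ) * (3 / 4) ^ D ≤ 4 * (15 / 16) ^ D := by
  have hB : 1 + (D : ℝ) * (1 / 4) ≤ (1 + 1 / 4) ^ D := one_add_mul_le_pow (by norm_num) D
  have e : (15 / 16 : ℝ) ^ D = (1 + 1 / 4) ^ D * (3 / 4) ^ D := by rw [← mul_pow]; norm_num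
  rw [e]
  have h0 : (0 : ℝ) ≤ (3 / 4) ^ D := by positivity
  nlinarith [mul_le_mul_of_nonneg_right hB h0]

/-- The scale: for `c ≥ 1` and `c² ≤ D`, `ρ = √(√D/c)` has `ρ² = √D/c`, `1 ≤ ρ`, `ρ⁶ ≤ D²` and `ρ^{32} = D⁸/c^{16}`.
[folklore] -/
theorem scale_facts {c : ℝ} (hc : 1 ≤ c) {D : ℕ} (hD1 : 1 ≤ D) (hDc : c ^ 2 ≤ D) :
    Real.sqrt (Real.sqrt D / c) ^ 2 = Real.sqrt D / c ∧ 1 ≤ Real.sqrt (Real.sqrt D / c) ∧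
      Real.sqrt (Real.sqrt D / c) ^ 6 ≤ (D : ℝ) ^ 2 ∧ Real.sqrt (Real.sqrt D / c) ^ 32 = (D : ℝ) ^ 8 / c ^ 16 := by
  have hc0 : 0 < c := lt_of_lt_of_le one_pos hc
  have hD0 : (0 : ℝ) ≤ D := D.cast_nonneg
  have hD1' : (1 : ℝ) ≤ D := by exact_mod_cast hD1
  have hsD : c ≤ Real.sqrt D := by
    rw [show c = Real.sqrt (c ^ 2) from (Real.sqrt_sq hc0.le).symm]; exact Real.sqrt_le_sqrt hDc
  have hq1 : 1 ≤ Real.sqrt D / c := by rwa [le_div_iff₀ hc0, one_mul]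
  have hq0 : 0 ≤ Real.sqrt D / c := le_trans zero_le_one hq1
  have h2 : Real.sqrt (Real.sqrt D / c) ^ 2 = Real.sqrt D / c := Real.sq_sqrt hq0
  refine ⟨h2, ?_, ?_, ?_⟩
  · rw [show (1:ℝ) = Real.sqrt 1 from Real.sqrt_one.symm]; exact Real.sqrt_le_sqrt hq1
  · have hsq : Real.sqrt D / c ≤ Real.sqrt D := div_le_self (Real.sqrt_nonneg _) hc
    have hsD' : Real.sqrt (D : ℝ) ≤ D := by rw [Real.sqrt_le_left hD0]; nlinarith
    calc Real.sqrt (Real.sqrt D / c) ^ 6 = (Real.sqrt (Real.sqrt D / c) ^ 2) ^ 3 := by ring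
      _ = (Real.sqrt D / c) ^ 3 := by rw [h2]
      _ ≤ Real.sqrt D ^ 3 := pow_le_pow_left₀ hq0 hsq 3
      _ = (D : ℝ) * Real.sqrt D := by
          rw [show (3:ℕ) = 2 + 1 by rfl, pow_succ, Real.sq_sqrt hD0]
      _ ≤ (D : ℝ) * D := mul_le_mul_of_nonneg_left hsD' hD0
      _ = (D : ℝ) ^ 2 := (sq _).symm
  · calc Real.sqrt (Real.sqrt D / c) ^ 32 = (Real.sqrt (Real.sqrt D / c) ^ 2) ^ 16 := by ring
      _ = (Real.sqrt D / c) ^ 16 := by rw [h2]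
      _ = (Real.sqrt D ^ 2) ^ 8 / c ^ 16 := by rw [div_pow]; ring
      _ = (D : ℝ) ^ 8 / c ^ 16 := by rw [Real.sq_sqrt hD0]

/-- **The light-cone regime** for the scale `ρ² = √D/c`, `c = 12eAτ'`, `τ ≤ τ'`: for all `n ≥ D ≥ 1`,
`2e · 3(Aρ²) √(1+2n) τ ≤ n` (indeed `≤ √(D(1+2n))/2 ≤ n`). [folklore] -/
theorem regime {A τ τ' ρ : ℝ} (hA : 0 < A) (hττ' : τ ≤ τ') (hτ'0 : 0 < τ')
    {D : ℕ} (hD1 : 1 ≤ D) (hρ2 : ρ ^ 2 = Real.sqrt D / (12 * Real.exp 1 * A * τ')) :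
    ∀ n : ℕ, D ≤ n → 2 * Real.exp 1 * (3 * (A * ρ ^ 2) * Real.sqrt (1 + ((2 * n : ℕ) : ℝ)) * τ) ≤ n := by
  intro n hn
  have he : 0 < Real.exp 1 := Real.exp_pos 1
  have hn1 : (1 : ℝ) ≤ n := by exact_mod_cast hD1.trans hn
  have hDn : (D : ℝ) ≤ n := by exact_mod_cast hn
  have hD0 : (0 : ℝ) ≤ D := D.cast_nonneg
  push_cast
  -- rewrite the left side as `(τ/τ') · √D √(1+2n) / 2`
  have e : 2 * Real.exp 1 * (3 * (A * ρ ^ 2) * Real.sqrt (1 + 2 * (n : ℝ)) * τ) =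
      (τ / τ') * (Real.sqrt D * Real.sqrt (1 + 2 * (n : ℝ)) / 2) := by
    rw [hρ2]; field_simp; ring
  rw [e]
  have hprod : Real.sqrt D * Real.sqrt (1 + 2 * (n : ℝ)) ≤ 2 * n := by
    rw [← Real.sqrt_mul hD0]
    calc Real.sqrt (D * (1 + 2 * (n : ℝ))) ≤ Real.sqrt ((2 * n) ^ 2) := Real.sqrt_le_sqrt (by nlinarith)
      _ = 2 * n := Real.sqrt_sq (by linarith)
  have hratio : τ / τ' ≤ 1 := (div_le_one hτ'0).2 hττ'
  have h0 : 0 ≤ Real.sqrt D * Real.sqrt (1 + 2 * (n : ℝ)) / 2 := by positivity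
  clear e hρ2
  calc τ / τ' * (Real.sqrt D * Real.sqrt (1 + 2 * (n : ℝ)) / 2) ≤ 1 * (Real.sqrt D * Real.sqrt (1 + 2 * (n : ℝ)) / 2) :=
        mul_le_mul_of_nonneg_right hratio h0
    _ = Real.sqrt D * Real.sqrt (1 + 2 * (n : ℝ)) / 2 := one_mul _
    _ ≤ 2 * (n : ℝ) / 2 := div_le_div_of_nonneg_right hprod (by norm_num)
    _ = n := by ring

end SingleFlip

open SingleFlip in
/-- **Registered helper `pinnedChain_singleFlipLocality`** (the dynamical engine of stub (C′)
`stub_uniformAnchoredCorrelationTails`, line `series-law-at-every-laplace-frequency`): the `N`-UNIFORM single-flip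
light cone of the open pinned anharmonic chain between its two Langevin baths at temperature `T > 0` — under the
stationary law `μ_T ⊗ W`, two strong solutions driven by the SAME Brownian pair from `x` and from `x` with the single
momentum `p_{i₀}` flipped see every bond current `j_k` at distance `≥ D ≥ D₀(τ)` from `i₀` differ, in mean square and
up to the horizon `τ`, by at most `(a r^D + b/D²)²` with `a, b ≥ 0`, `r = 15/16`, all independent of `N`, `i₀`, `k`
(weighted common-noise propagation bound + `N`-uniform weighted box + `N`-uniform Gibbs fourth moments). [folklore] -/
theorem pinnedChain_singleFlipLocality :
    ∀ ω₂ lam β γ : ℝ, 0 < ω₂ → 0 < lam → 0 < β → 0 < γ → ∀ T : ℝ, 0 < T → ∀ τ : ℝ, 0 < τ →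
      ∃ a b r : ℝ, 0 ≤ a ∧ 0 ≤ b ∧ 0 ≤ r ∧ r < 1 ∧ ∃ D₀ : ℕ, 1 ≤ D₀ ∧
        ∀ (N : ℕ) (i₀ k : Fin N), (k : ℕ) + 1 < N → ∀ D : ℕ, D₀ ≤ D →
          D ≤ ((k : ℤ) - i₀).natAbs → D ≤ ((k : ℤ) + 1 - i₀).natAbs → ∀ s : NNReal, (s : ℝ) ≤ τ →
            ∫⁻ x, ∫⁻ ω, ENNReal.ofReal
                (((Literature.MathematicalPhysics.KineticTheory.HeatConduction.pinnedChain ω₂ lam β γ).bondCurrent N k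
                    ((Literature.MathematicalPhysics.KineticTheory.HeatConduction.pinnedChain ω₂ lam β γ).solMap N T T s
                      (Literature.MathematicalPhysics.KineticTheory.HeatConduction.momentumFlip i₀ x)
                      (Literature.Probability.Process.pairPath ω)) -
                  (Literature.MathematicalPhysics.KineticTheory.HeatConduction.pinnedChain ω₂ lam β γ).bondCurrent N k
                    ((Literature.MathematicalPhysics.KineticTheory.HeatConduction.pinnedChain ω₂ lam β γ).solMap N T T s
                      x (Literature.Probability.Process.pairPath ω))) ^ 2)
                ∂Literature.Probability.Process.wienerPair
                ∂((Literature.MathematicalPhysics.KineticTheory.HeatConduction.pinnedChain ω₂ lam β γ).gibbsMeasure N T) ≤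
              ENNReal.ofReal ((a * r ^ D + b / (D : ℝ) ^ 2) ^ 2) := by
  intro ω₂ lam β γ hω hl hβ hγ T hT τ hτ
  set P := pinnedChain ω₂ lam β γ with hP
  -- constants (introduced opaquely: no `set`-abstraction over `Real.exp`)
  obtain ⟨A, hA⟩ : ∃ A : ℝ, A = 3 + ω₂ + 3 * lam + 24 * β + 2 * γ := ⟨_, rfl⟩
  have hA0 : 0 < A := by rw [hA]; positivity
  have hA3 : 3 ≤ A := by rw [hA]; linarith [hl.le, hβ.le, hγ.le, hω.le]
  obtain ⟨τ', hτ'⟩ : ∃ τ' : ℝ, τ' = max τ 1 := ⟨_, rfl⟩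
  have hτ'1 : 1 ≤ τ' := by rw [hτ']; exact le_max_right _ _
  have hττ' : τ ≤ τ' := by rw [hτ']; exact le_max_left _ _
  have hτ'0 : 0 < τ' := lt_of_lt_of_le one_pos hτ'1
  obtain ⟨c, hc⟩ : ∃ c : ℝ, c = 12 * Real.exp 1 * A * τ' := ⟨_, rfl⟩
  have he1 : 1 ≤ Real.exp 1 := Real.one_le_exp one_pos.le
  have hc1 : 1 ≤ c := by
    rw [hc]
    have : (1:ℝ) ≤ 12 * Real.exp 1 := by nlinarith
    calc (1:ℝ) ≤ 12 * Real.exp 1 := this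
      _ = 12 * Real.exp 1 * 1 * 1 := by ring
      _ ≤ 12 * Real.exp 1 * A * τ' := by gcongr; linarith
  have hc0 : 0 < c := lt_of_lt_of_le one_pos hc1
  obtain ⟨K, hK0, hK⟩ := pinnedChain_weightedBox_exceptionalSet ω₂ lam β γ hω hl.le hβ.le hγ.le T hT τ hτ
  obtain ⟨C₄, hC₄0, hC₄⟩ := pinnedChain_contactCurrentFourthMoment ω₂ lam β γ hω hl.le hβ.le T hT
  obtain ⟨a, ha⟩ : ∃ a : ℝ, a = 672 * (1 + β) * Real.sqrt (195 * T ^ 2 + 32) := ⟨_, rfl⟩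
  have ha0 : 0 ≤ a := by rw [ha]; positivity
  obtain ⟨b, hb⟩ : ∃ b : ℝ, b = Real.sqrt (4 * Real.sqrt (C₄ * (2 * K)) * c ^ 8) := ⟨_, rfl⟩
  have hb0 : 0 ≤ b := by rw [hb]; exact Real.sqrt_nonneg _
  have hb2 : b ^ 2 = 4 * Real.sqrt (C₄ * (2 * K)) * c ^ 8 := by rw [hb]; exact Real.sq_sqrt (by positivity)
  obtain ⟨D₀, hD₀⟩ : ∃ D₀ : ℕ, D₀ = ⌈c ^ 2⌉₊ + 1 := ⟨_, rfl⟩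
  refine ⟨a, b, 15 / 16, ha0, hb0, by norm_num, by norm_num, D₀, by omega, ?_⟩
  intro N i₀ k hk D hD hDk hDk1 s hs
  have hD1 : 1 ≤ D := by omega
  have hDc : c ^ 2 ≤ D := by
    have h1 : ⌈c ^ 2⌉₊ ≤ D := by omega
    exact le_trans (Nat.le_ceil _) (by exact_mod_cast h1)
  have hD0 : (0 : ℝ) < D := by exact_mod_cast hD1
  -- the scale
  obtain ⟨hρ2, hρ1, hρ6, hρ32⟩ := scale_facts hc1 hD1 hDc
  set ρ : ℝ := Real.sqrt (Real.sqrt D / c) with hρ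
  have hreg := regime (ρ := ρ) hA0 hττ' hτ'0 hD1 (by rw [hρ2, hc])
  rw [hA] at hreg
  -- the exceptional set at this scale
  obtain ⟨E, hEm, hEπ, hbox⟩ := hK N i₀ ρ hρ1
  have hEπ' : ((P.gibbsMeasure N T).prod wienerPair) E ≤ ENNReal.ofReal (K * c ^ 16 / (D : ℝ) ^ 8) := by
    refine hEπ.trans (le_of_eq ?_)
    rw [hρ32]; congr 1; field_simp
  have hbK : 0 ≤ K * c ^ 16 / (D : ℝ) ^ 8 := by positivity
  -- the weighted single-flip estimate
  have est := single_flip_weighted hω hl hβ hγ hT i₀ k hk hD1 hDk hDk1 hρ1 hreg E hEm hbK hEπ' hbox hC₄0 (hC₄ N k) s hs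
  refine est.trans ?_
  -- the cone term
  have hX : 28224 * (1 + β) ^ 2 * ρ ^ 6 * (9 / 16) ^ D * (195 * T ^ 2 + 32) ≤ (a * (15 / 16) ^ D) ^ 2 := by
    have hB := mul_threeQuarter_pow_le D
    have h916 : ((9 / 16 : ℝ)) ^ D = ((3 / 4) ^ D) ^ 2 := by rw [← pow_mul, pow_mul']; norm_num
    have h1 : ρ ^ 6 * (9 / 16) ^ D ≤ (4 * (15 / 16) ^ D) ^ 2 := by
      calc ρ ^ 6 * (9 / 16) ^ D ≤ (D : ℝ) ^ 2 * (9 / 16) ^ D := mul_le_mul_of_nonneg_right hρ6 (by positivity)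
        _ = ((D : ℝ) * (3 / 4) ^ D) ^ 2 := by rw [h916]; ring
        _ ≤ (4 * (15 / 16) ^ D) ^ 2 := pow_le_pow_left₀ (by positivity) hB 2
    have hsq : Real.sqrt (195 * T ^ 2 + 32) ^ 2 = 195 * T ^ 2 + 32 := Real.sq_sqrt (by positivity)
    calc 28224 * (1 + β) ^ 2 * ρ ^ 6 * (9 / 16) ^ D * (195 * T ^ 2 + 32)
        = 28224 * (1 + β) ^ 2 * (195 * T ^ 2 + 32) * (ρ ^ 6 * (9 / 16) ^ D) := by ring
      _ ≤ 28224 * (1 + β) ^ 2 * (195 * T ^ 2 + 32) * (4 * (15 / 16) ^ D) ^ 2 :=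
          mul_le_mul_of_nonneg_left h1 (by positivity)
      _ = (a * (15 / 16) ^ D) ^ 2 := by rw [ha, mul_pow, mul_pow, mul_pow, hsq]; ring
  -- the bad term
  have hY : 4 * Real.sqrt (C₄ * (2 * (K * c ^ 16 / (D : ℝ) ^ 8))) = (b / (D : ℝ) ^ 2) ^ 2 := by
    rw [div_pow, hb2, show C₄ * (2 * (K * c ^ 16 / (D : ℝ) ^ 8)) = C₄ * (2 * K) * (c ^ 8 / (D : ℝ) ^ 4) ^ 2 by
      field_simp, Real.sqrt_mul (by positivity), Real.sqrt_sq (by positivity)]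
    field_simp
  have hX0 : 0 ≤ 28224 * (1 + β) ^ 2 * ρ ^ 6 * (9 / 16) ^ D * (195 * T ^ 2 + 32) := by
    have := le_trans zero_le_one hρ1; positivity
  have hY0 : 0 ≤ 4 * Real.sqrt (C₄ * (2 * (K * c ^ 16 / (D : ℝ) ^ 8))) := by positivity
  rw [← ENNReal.ofReal_add hX0 hY0]
  refine ENNReal.ofReal_le_ofReal ?_
  rw [hY]
  have hcross : 0 ≤ 2 * (a * (15 / 16) ^ D) * (b / (D : ℝ) ^ 2) := by positivity
  nlinarith [hX, hcross]

/-- **Stub (C′) `stub_uniformAnchoredCorrelationTails`** (line `series-law-at-every-laplace-frequency`, crux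
`LatticeLandauDamping.AbelThermodynamicLimit`) — the registered text VERBATIM: the light cone of the open pinned chain at
fixed time, anchor-uniform and `N`-uniform, from the `N`-uniform single-flip light cone (`pinnedChain_singleFlipLocality`)
through the kernel-level reduction (`uniformAnchoredCorrelationTails_of_singleFlipLocality`). -/
theorem stub_uniformAnchoredCorrelationTails :
∀ ω₂ lam β γ : ℝ, 0 < ω₂ → 0 < lam → 0 < β → 0 < γ → ∀ T : ℝ, 0 < T →
      ∀ τ : ℝ, 0 < τ → ∀ ε : ℝ, 0 < ε → ∃ R N₀ : ℕ, ∀ N : ℕ, N₀ ≤ N → ∀ i : Fin N,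
        R ≤ i.val → i.val + R < N → ∀ t ∈ Set.Icc (0 : ℝ) τ,
          (∑ k : Fin N, if i.val ≤ k.val + R ∧ k.val ≤ i.val + R then (0 : ℝ) else
            |∫ z, (Literature.MathematicalPhysics.KineticTheory.HeatConduction.pinnedChain
                    ω₂ lam β γ).bondCurrent N i z *
                (∫ y, (Literature.MathematicalPhysics.KineticTheory.HeatConduction.pinnedChain
                    ω₂ lam β γ).bondCurrent N k y
                  ∂((Literature.MathematicalPhysics.KineticTheory.HeatConduction.pinnedChain
                    ω₂ lam β γ).transitionKernel N T T t.toNNReal z))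
              ∂((Literature.MathematicalPhysics.KineticTheory.HeatConduction.pinnedChain
                    ω₂ lam β γ).gibbsMeasure N T)|) ≤ ε :=
  uniformAnchoredCorrelationTails_of_singleFlipLocality pinnedChain_singleFlipLocality

end Summit.AtomisticToContinuum.FouriersLaw.Theorems.AbelThermodynamicLimit.SeriesLawAtEveryLaplaceFrequency

end
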